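import Summits.QuantumFields.YangMills.Theorems.BalabanUVNodesN20KeyedRelWeightValueStrata

/-!
# BalabanUVNodes ∕ N20 (NE7b) — THE CANONICAL WEIGHT IS MONOTONE AND SUBADDITIVE IN THE BAD READING; THE UNION READING's SOCKET; and the «PENDING»-SHAPED DIAL of (1.80)'s
# size-dependent window (a union over the window's levels of per-level SIZE thresholds growing linearly with the AGE) priced by per-(level, size) geometric letters REDUCES TO THE AGE RULE at rate `q^c`

Cell `pub-ymgap` (HUMAN RULING D-0062 Track A; work-bound push D-0149, director-ym №197), width seat `pub-ymgap-dag-n20-w2` (gen 4) on node N20 = NE7b; CLAIM-2 of the re-seat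
(this lineage's object: the canonical fraction of the N20 face and its sockets at dag-n20-d's key-reading edition `crOfRecord₁₃KAt K₀ kr bd sh`, p608328).  Filed `--kind proof --supports
stmt-QuantumFields-20544 --as helper` (K3⁷ `SpineGivenEndpointR13SepCoPH`; skeleton v5 941dddb108cbaacf STANDS); COUNT-NEUTRAL; LOCATED.  Companion of gen 3's AGE socket
(`…N20KeyedRelWeightLevels ∕ …AtKeyReading ∕ …AtForgivingKey`) and gen 4's SIZE socket (`…N20KeyedRelWeightValueStrata`, p620106).
[III] = [Balaban1988Convergent], [LF-I] = [Balaban1989LargeFieldI], [LF-II] = [Balaban1989LargeFieldII].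

WHY.  The bad-key reading `bd` of the K-edition is a DIAL; the readings typed so far are single predicates (a level cut; a size threshold).  [LF-II] (1.80) p.384 keeps a large-field
region «pending» for a number of steps `K(Z)` that GROWS with the region, so the two natural composite bookings are UNIONS over the window's levels of per-level readings: (P) «still
pending» = at some level the size statistic passes a threshold growing with the level's AGE (large-for-its-age; typed in §3–§4), and (O) «over-aged» = an un-absorbed birth OLDER than
an age floor `j⋆(K)` (the crux cards' (AC) ∕ (V-a) booking, `Cruxes/…/OVERAGE-RATE-READING-idea3-g13.md`) = gen 3's level-cut reading with cut `K₀+K−j⋆(K)` at the forgiving key, priced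
by the survival socket p617084 §1 (its log-margin design rule is a separate file).  This file supplies the algebra such composite dials need and prices (P): (§1–§2) at fixed carriers the canonical weight `wInf` is MONOTONE in the bad class (a sub-reading costs less; step-local form of gen 2's `wInf_mono_of_subset`) and
SUBADDITIVE under finite unions (the sum of admissible weights of the pieces is admissible for any class inside their union), so at the reading `W(⋁_j bd_j) K ≤ Σ_j W(bd_j) K` and
`RelWeightBound` at a union-dominated reading follows from per-piece budgets with `Σ_j < 1` summable; (§3) for the pending-shaped dial (P) `bd K u ⟺ ∃ j < jcut K, n j K ≤ φ j K u` with
per-level statistics `φ j` and thresholds `n j K ≥ n₀ K + c·(K₀ + K − (j+1))` (linear in the AGE of level `j+1`, slope `c ≥ 1`), the per-(level, size) geometric letter «the classes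
with `φ j K = m` carry at most `V·q^m` of each run's keyed mass, for `m ≥ n j K` ONLY» gives, through p620106 §3 per level and gen 3's age sum, `W K ≤ V·q^{n₀ K}·(q^c)^{K₀+K−jcut K} ∕
((1−q)(1−q^c))` — the AGE majorant of p617084 at rate `r := q^c` and entropy `V·q^{n₀ K}∕(1−q)`: the pending-shaped dial asks the large-deviation letter only ABOVE an age-linear
size threshold and inherits the age currency's design rule (threshold floor `n₀ K` and∕or age floor `K₀+K−jcut K` supplying `< 1` and summability over the steps).
CONTENTS (theorems only; 0 `def`):
* §1 (folklore) `sum_union_le_of_nonneg` · `sum_biUnion_le_sum_of_nonneg` · `admW_anti_at` · `wInf_mono_at` · `sum_mem_admW_of_subset_biUnion` · `wInf_le_sum_wInf_of_subset_biUnion` ·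
  `pow_le_pow_mul_pow_of_le` · `sum_range_pow_threshold_le`;
* §2 (n20-d's coarse carriers, ANY dial; every tuple with core provisos) `badClassK₁₃_existsReading_eq_biUnion` · ★ `W_crOfRecord₁₃KAt_mono_bad` · ★★ `W_crOfRecord₁₃KAt_le_sum_of_subset_biUnion`
  · ★★ `relWeightBound_crOfRecord₁₃KAt_of_pieceBudgets`;
* §3 (the pending-shaped dial (P)) ★★ `W_crOfRecord₁₃KAt_pending_le_sum_geometric` · ★★ `W_crOfRecord₁₃KAt_pending_le_ageMajorant` · ★★★ `relWeightBound_crOfRecord₁₃KAt_pending_of_geometric`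
  (THE DESIGN RULE) · `relWeightBound_crOfRecord₁₃KAt_pending_of_geometric_linearAge` · `relWeightBound_crOfRecord₁₃KAt_pending_of_geometric_thresholdFloor` (no cut needed);
* §4 (instance at the NAMED forgiving key `forgiveCompReading₁₃ K₀ c`, pieces «un-absorbed large-field volume at level `j+1` ≥ `nR j`», dag-n20-d's key-step spelling)
  ★★ `relWeightBound_forgiveCompReading₁₃_pending_of_geometric`.
Cited BY NAME, not re-typed: dag-n20-d `…SpineReadingOfRecord13CoPHK` (`crOfRecord₁₃KAt`, `classSetK₁₃`, `badClassK₁₃`, `weightAK₁₃ ∕ weightBK₁₃`, `mem_badClassK₁₃_iff`, `badClassK₁₃_subset`),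
`…SpineCanonicalWeights` (`admW`, `wInf`, `wInf_le_of_mem`, `wInf_nonneg`, `wInf_mem_of_nonempty`), gen 2 `…Canonical` §1 (`one_mem_admW`), this seat's `…AtKeyReading` §1
(`relWeightBound_crOfRecord₁₃KAt_iff`, `weightAK₁₃_nonneg_of_provisos`), `…ValueStrata` §3 (`W_crOfRecord₁₃KAt_thr_le_geometric`), `…Levels` §1 (`sum_range_pow_age_le`, `summable_ageMajorant_of_linearAge`).

HONEST FRAMING.  [folklore] finite-sum ∕ real-analysis bookkeeping BY NAME over dag-n20-d's readings and the tree's SHAPES; every per-piece budget ∕ per-(level, size) geometric letter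
is a HYPOTHESIS — NE7b's body at the coarse key ((AC)-type multi-block large deviations per birth level; [LF-II] (1.89) prints ABSOLUTE per-cube factors only), NAMED OPEN, NOT PRINTED
for `d = 4`, NOT proved, inhabited here for no Bałaban family; NO weight bounded, NO estimate proved.  The pending-shaped dial (P) is ONE key-language shape of (1.80)'s size-dependent window, NOT Bałaban's
`K(Z)` (which is region-relative and needs (i), (ii) of [LF-I] p.177 — n20-d's caveat); which statistics `φ j` (level volumes, un-absorbed component sizes) and which thresholds escape
the saturation walls (p597932, p610465 §4) is NOT decided here.  Nothing of Bałaban's is asserted; NE7 ∕ NE7b ∕ NE7c NOT PRINTED for `d = 4`, NOT proved; (α)-instance 0∕1; no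
`Provisos₁₃CoPH` inhabitant claimed (K0⁷ OPEN); N19 ∕ N20 ∕ N21 ∕ N27 NOT discharged; K3⁷ NOT closed (v5 stands; no dial ∕ bad reading is pinned by any registered text); counts
unmoved (typed 28∕28 · discharged 5∕27); no count claim (the chair's single count line is the only count).  One finite `𝕋⁴_{L^K}` programme at fixed `ε = L^{−K}`, Bałaban AS
PRINTED; the YM mass gap (Clay) is NOT proved by any of this — R4 closes the conditional finite-𝕋⁴ rung `BalabanLadder.UV` only; NOT ℝ⁴ ∕ infinite volume ∕ OS.  No `def` ∕ `instance`
∕ `notation` ∕ `sorry`.  Sources (locators only): [LF-II] Thm 1 + (0.1) pp.355–356, (1.79)–(1.80) pp.383–384, (1.85) p.386, (1.89) p.387; [LF-I] (0.2) p.176, p.177; [III] (2.18) p.257,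
p.244; [King1986] (3.10)–(3.11) p.656.
-/

noncomputable section

open scoped BigOperators
open _root_.Filter _root_.Topology

namespace Summit.QuantumFields.YangMills.BalabanUVNodes.N20KeyedRelWeightUnionReading

open Literature.MathematicalPhysics.QuantumFieldTheory.Balaban1983to89 Literature.MathematicalPhysics.QuantumFieldTheory.Balaban1983to89.Node00
open T4Continuum
open T4WeightBudget (RelWeightBound)
open YMDAG.UVSplit hiding SU
open Summit.QuantumFields.YangMills.BalabanUVNodes.SpineCanonicalWeights
open Summit.QuantumFields.YangMills.BalabanUVNodes.N20KeyedRelWeightCanonical (one_mem_admW)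
open Summit.QuantumFields.YangMills.BalabanUVNodes.N20KeyedRelWeightLevels (sum_range_pow_age_le summable_ageMajorant_of_linearAge)
open Summit.QuantumFields.YangMills.BalabanUVNodes.N20KeyedRelWeightAtKeyReading
open Summit.QuantumFields.YangMills.BalabanUVNodes.N20KeyedRelWeightValueStrata
open Summit.QuantumFields.YangMills.BalabanUVNodes.N20KeyedRelWeightAtForgivingKey (forgiveKeyCompSigma_fst_eq)

variable {F : T4Family} {N : ℕ} [NeZero N]

/-! ## §1  Folklore: union bounds for non-negative sums; the canonical weight is monotone and subadditive in the bad class (step-local); the age-linear threshold sum -/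
section Folklore
variable {ι : Type*} {l₀ : ℝ} {T : ℕ → Finset ι} {A B : ℕ → ℝ → ι → ℝ}

/-- **A LARGER CLASS HAS FEWER ADMISSIBLE WEIGHTS — AT ONE STEP** (terms non-negative on `T K`, `Bad K t ⊆ Bad' K t ⊆ T K` for `|t| ≤ l₀`): the step-local form of gen 2's
`admW_subset_admW_of_subset`. [cite: King1986, (3.10)–(3.11) p.656 (bookkeeping)] -/
theorem admW_anti_at {Bad Bad' : ℕ → ℝ → Finset ι} {K : ℕ} (hA : ∀ t : ℝ, |t| ≤ l₀ → ∀ τ ∈ T K, 0 ≤ A K t τ) (hB : ∀ t : ℝ, |t| ≤ l₀ → ∀ τ ∈ T K, 0 ≤ B K t τ)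
    (hBB : ∀ t : ℝ, |t| ≤ l₀ → Bad K t ⊆ Bad' K t) (hsub' : ∀ t : ℝ, |t| ≤ l₀ → Bad' K t ⊆ T K) :
    admW l₀ T A B Bad' K ⊆ admW l₀ T A B Bad K := fun _ hw =>
  ⟨hw.1, fun t ht =>
    ⟨(Finset.sum_le_sum_of_subset_of_nonneg (hBB t ht) fun τ hτ _ => hA t ht τ (hsub' t ht hτ)).trans (hw.2 t ht).1,
      (Finset.sum_le_sum_of_subset_of_nonneg (hBB t ht) fun τ hτ _ => hB t ht τ (hsub' t ht hτ)).trans (hw.2 t ht).2⟩⟩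

/-- **★ THE CANONICAL WEIGHT IS MONOTONE IN THE BAD CLASS — AT ONE STEP** (`Bad K · ⊆ Bad' K · ⊆ T K`, non-negative terms, `Bad'`'s admissible weights non-empty at `K`).
[cite: King1986, (3.10)–(3.11) p.656; Balaban1989LargeFieldII, (1.80) p.384 (bookkeeping)] -/
theorem wInf_mono_at {Bad Bad' : ℕ → ℝ → Finset ι} {K : ℕ} (hA : ∀ t : ℝ, |t| ≤ l₀ → ∀ τ ∈ T K, 0 ≤ A K t τ) (hB : ∀ t : ℝ, |t| ≤ l₀ → ∀ τ ∈ T K, 0 ≤ B K t τ)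
    (hBB : ∀ t : ℝ, |t| ≤ l₀ → Bad K t ⊆ Bad' K t) (hsub' : ∀ t : ℝ, |t| ≤ l₀ → Bad' K t ⊆ T K) (hne : (admW l₀ T A B Bad' K).Nonempty) :
    wInf l₀ T A B Bad K ≤ wInf l₀ T A B Bad' K :=
  wInf_le_of_mem (admW_anti_at hA hB hBB hsub' (wInf_mem_of_nonempty hne))

/-- **A THRESHOLD LINEAR IN THE AGE SPLITS THE GEOMETRIC FACTOR**: `n₀ + c·a ≤ n`, `0 ≤ q ≤ 1` ⇒ `q^n ≤ q^{n₀}·(q^c)^a`. [cite: Balaban1989LargeFieldII, (1.80) p.384 (bookkeeping)] -/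
theorem pow_le_pow_mul_pow_of_le {q : ℝ} (h0 : 0 ≤ q) (h1 : q ≤ 1) {n n₀ c a : ℕ} (h : n₀ + c * a ≤ n) : q ^ n ≤ q ^ n₀ * (q ^ c) ^ a := by
  rw [← pow_mul, ← pow_add]
  exact pow_le_pow_of_le_one h0 h1 h

/-- **THE AGE-LINEAR THRESHOLD SUM OVER THE WINDOW's LEVELS**: thresholds `n j ≥ n₀ + c·(K₀+K−(j+1))` (`c ≥ 1`), cut inside the window `jc ≤ K₀ + K`, `0 ≤ q < 1` ⇒
`Σ_{j<jc} q^{n j} ≤ q^{n₀}·(q^c)^{K₀+K−jc}∕(1−q^c)` (gen 3's age sum `sum_range_pow_age_le` at the rate `q^c`). [cite: Balaban1989LargeFieldII, (1.80) p.384, (1.89) p.387; King1986, (3.10)–(3.11) p.656 (bookkeeping)] -/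
theorem sum_range_pow_threshold_le {q : ℝ} (h0 : 0 ≤ q) (h1 : q < 1) {c : ℕ} (hc : 1 ≤ c) {K₀ K jc n₀ : ℕ} (hwin : jc ≤ K₀ + K) {n : ℕ → ℕ}
    (hlin : ∀ j < jc, n₀ + c * (K₀ + K - (j + 1)) ≤ n j) :
    ∑ j ∈ Finset.range jc, q ^ n j ≤ q ^ n₀ * ((q ^ c) ^ (K₀ + K - jc) / (1 - q ^ c)) := by
  have hqc1 : q ^ c < 1 := pow_lt_one₀ h0 h1 (by omega)
  calc ∑ j ∈ Finset.range jc, q ^ n j ≤ ∑ j ∈ Finset.range jc, q ^ n₀ * (q ^ c) ^ (K₀ + K - (j + 1)) :=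
        Finset.sum_le_sum fun j hj => pow_le_pow_mul_pow_of_le h0 h1.le (hlin j (Finset.mem_range.1 hj))
    _ = q ^ n₀ * ∑ j ∈ Finset.range jc, (q ^ c) ^ (K₀ + K - (j + 1)) := (Finset.mul_sum _ _ _).symm
    _ ≤ q ^ n₀ * ((q ^ c) ^ (K₀ + K - jc) / (1 - q ^ c)) := mul_le_mul_of_nonneg_left (sum_range_pow_age_le (pow_nonneg h0 c) hqc1 hwin) (pow_nonneg h0 _)

variable [DecidableEq ι]

/-- **UNION BOUND** for a sum of terms non-negative on the second set: `Σ_{s ∪ t} f ≤ Σ_s f + Σ_t f`. [cite: King1986, (3.10)–(3.11) p.656 (bookkeeping)] -/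
theorem sum_union_le_of_nonneg (s t : Finset ι) (f : ι → ℝ) (ht : ∀ i ∈ t, 0 ≤ f i) : ∑ i ∈ s ∪ t, f i ≤ ∑ i ∈ s, f i + ∑ i ∈ t, f i := by
  have h := Finset.sum_union_inter (s₁ := s) (s₂ := t) (f := f)
  have h0 : 0 ≤ ∑ i ∈ s ∩ t, f i := Finset.sum_nonneg fun i hi => ht i (Finset.mem_inter.1 hi).2
  linarith

/-- **FINITE UNION BOUND**: `Σ_{⋃_{j∈J} S j} f ≤ Σ_{j∈J} Σ_{S j} f` for `f ≥ 0` on the pieces. [cite: King1986, (3.10)–(3.11) p.656 (bookkeeping)] -/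
theorem sum_biUnion_le_sum_of_nonneg (J : Finset ℕ) (S : ℕ → Finset ι) (f : ι → ℝ) (hf : ∀ j ∈ J, ∀ i ∈ S j, 0 ≤ f i) :
    ∑ i ∈ J.biUnion S, f i ≤ ∑ j ∈ J, ∑ i ∈ S j, f i := by
  induction J using Finset.induction_on with
  | empty => simp
  | insert a J ha ih =>
    rw [Finset.biUnion_insert, Finset.sum_insert ha]
    have hJ : ∀ j ∈ J, ∀ i ∈ S j, 0 ≤ f i := fun j hj => hf j (Finset.mem_insert_of_mem hj)
    exact (sum_union_le_of_nonneg (S a) (J.biUnion S) f fun i hi => by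
        obtain ⟨j, hj, hij⟩ := Finset.mem_biUnion.1 hi
        exact hJ j hj i hij).trans (by linarith [ih hJ])

/-- **THE SUM OF ADMISSIBLE WEIGHTS OF THE PIECES IS ADMISSIBLE FOR ANY CLASS INSIDE THEIR UNION** (one step; terms non-negative on `T K`; pieces inside `T K`).
[cite: King1986, (3.10)–(3.11) p.656; Balaban1989LargeFieldII, (1.80) p.384 (bookkeeping)] -/
theorem sum_mem_admW_of_subset_biUnion {J : Finset ℕ} {Bad : ℕ → ℕ → ℝ → Finset ι} {BadU : ℕ → ℝ → Finset ι} {K : ℕ} {w : ℕ → ℝ}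
    (hA : ∀ t : ℝ, |t| ≤ l₀ → ∀ τ ∈ T K, 0 ≤ A K t τ) (hB : ∀ t : ℝ, |t| ≤ l₀ → ∀ τ ∈ T K, 0 ≤ B K t τ)
    (hsub : ∀ j ∈ J, ∀ t : ℝ, |t| ≤ l₀ → Bad j K t ⊆ T K) (hU : ∀ t : ℝ, |t| ≤ l₀ → BadU K t ⊆ J.biUnion fun j => Bad j K t)
    (hw : ∀ j ∈ J, w j ∈ admW l₀ T A B (Bad j) K) : ∑ j ∈ J, w j ∈ admW l₀ T A B BadU K := by
  have hUT : ∀ t : ℝ, |t| ≤ l₀ → (J.biUnion fun j => Bad j K t) ⊆ T K := fun t ht u hu => by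
    obtain ⟨j, hj, huj⟩ := Finset.mem_biUnion.1 hu
    exact hsub j hj t ht huj
  refine ⟨Finset.sum_nonneg fun j hj => (hw j hj).1, fun t ht => ⟨?_, ?_⟩⟩
  · calc ∑ τ ∈ BadU K t, A K t τ ≤ ∑ τ ∈ J.biUnion (fun j => Bad j K t), A K t τ :=
          Finset.sum_le_sum_of_subset_of_nonneg (hU t ht) fun τ hτ _ => hA t ht τ (hUT t ht hτ)
      _ ≤ ∑ j ∈ J, ∑ τ ∈ Bad j K t, A K t τ := sum_biUnion_le_sum_of_nonneg J _ _ fun j hj τ hτ => hA t ht τ (hsub j hj t ht hτ)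
      _ ≤ ∑ j ∈ J, w j * ∑ τ ∈ T K, A K t τ := Finset.sum_le_sum fun j hj => ((hw j hj).2 t ht).1
      _ = (∑ j ∈ J, w j) * ∑ τ ∈ T K, A K t τ := (Finset.sum_mul _ _ _).symm
  · calc ∑ τ ∈ BadU K t, B K t τ ≤ ∑ τ ∈ J.biUnion (fun j => Bad j K t), B K t τ :=
          Finset.sum_le_sum_of_subset_of_nonneg (hU t ht) fun τ hτ _ => hB t ht τ (hUT t ht hτ)
      _ ≤ ∑ j ∈ J, ∑ τ ∈ Bad j K t, B K t τ := sum_biUnion_le_sum_of_nonneg J _ _ fun j hj τ hτ => hB t ht τ (hsub j hj t ht hτ)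
      _ ≤ ∑ j ∈ J, w j * ∑ τ ∈ T K, B K t τ := Finset.sum_le_sum fun j hj => ((hw j hj).2 t ht).2
      _ = (∑ j ∈ J, w j) * ∑ τ ∈ T K, B K t τ := (Finset.sum_mul _ _ _).symm

/-- **★ THE CANONICAL WEIGHT IS SUBADDITIVE UNDER FINITE UNIONS — AT ONE STEP**: `BadU K · ⊆ ⋃_{j∈J} Bad j K ·`, pieces inside `T K` with non-empty admissible weights, non-negative terms ⇒
`wInf … BadU K ≤ Σ_{j∈J} wInf … (Bad j) K`. [cite: King1986, (3.10)–(3.11) p.656; Balaban1989LargeFieldII, (1.80) p.384 (bookkeeping)] -/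
theorem wInf_le_sum_wInf_of_subset_biUnion {J : Finset ℕ} {Bad : ℕ → ℕ → ℝ → Finset ι} {BadU : ℕ → ℝ → Finset ι} {K : ℕ}
    (hA : ∀ t : ℝ, |t| ≤ l₀ → ∀ τ ∈ T K, 0 ≤ A K t τ) (hB : ∀ t : ℝ, |t| ≤ l₀ → ∀ τ ∈ T K, 0 ≤ B K t τ)
    (hsub : ∀ j ∈ J, ∀ t : ℝ, |t| ≤ l₀ → Bad j K t ⊆ T K) (hU : ∀ t : ℝ, |t| ≤ l₀ → BadU K t ⊆ J.biUnion fun j => Bad j K t)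
    (hne : ∀ j ∈ J, (admW l₀ T A B (Bad j) K).Nonempty) : wInf l₀ T A B BadU K ≤ ∑ j ∈ J, wInf l₀ T A B (Bad j) K :=
  wInf_le_of_mem (sum_mem_admW_of_subset_biUnion hA hB hsub hU fun j hj => wInf_mem_of_nonempty (hne j hj))

end Folklore

/-! ## §2  At dag-n20-d's coarse carriers, ANY dial: the union reading, monotonicity and subadditivity of the reading's canonical `W` in the bad reading -/
section Union
variable (θ : Stage13HParams F N) (hP : θ.Provisos₁₃CoPH F N) (K₀ : ℕ) (g₀ : ℕ → ℝ) (os : List (ULoop F)) (krR : KeyReading₁₃ N K₀) (sh : ShellSplit₁₃CoPH N K₀)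

/-- **★ THE READING's `W` IS MONOTONE IN THE BAD READING** (at one step; pointwise implication ON THE COARSE CLASS SET suffices): a sub-reading costs at most as much — every tuple with core
provisos, every dial. [cite: King1986, (3.10)–(3.11) p.656; Balaban1989LargeFieldII, (1.80) p.384 (bookkeeping)] -/
theorem W_crOfRecord₁₃KAt_mono_bad (bdR bdR' : BadKeyReading₁₃ N K₀) (K : ℕ)
    (h : ∀ u ∈ classSetK₁₃ θ K₀ g₀ (krR F θ hP g₀ os) K, bdR F θ hP g₀ os K u → bdR' F θ hP g₀ os K u) :
    (crOfRecord₁₃KAt K₀ krR bdR sh F θ hP g₀ os).W K ≤ (crOfRecord₁₃KAt K₀ krR bdR' sh F θ hP g₀ os).W K :=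
  wInf_mono_at (fun t _ u _ => weightAK₁₃_nonneg_of_provisos θ hP K₀ g₀ os (krR F θ hP g₀ os) K t u)
    (fun t _ u _ => weightBK₁₃_nonneg_of_provisos θ hP K₀ g₀ os (krR F θ hP g₀ os) K t u)
    (fun t _ u hu => by
      rw [mem_badClassK₁₃_iff] at hu ⊢
      exact ⟨hu.1, h u hu.1 hu.2⟩)
    (fun t _ => badClassK₁₃_subset θ K₀ g₀ (krR F θ hP g₀ os) (bdR' F θ hP g₀ os) K t)
    ⟨1, one_mem_admW_carriersK₁₃ θ hP K₀ g₀ os (krR F θ hP g₀ os) (bdR' F θ hP g₀ os) K⟩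

variable [DecidableEq (Σ K, SiteSeqKey F (K₀ + K))]

/-- **THE UNION READING's COARSE BAD CLASS IS THE UNION OF THE PIECES' CLASSES** (`bd K u := ∃ j ∈ J K, bd_j K u`, any dial). [cite: Balaban1989LargeFieldII, (1.80) p.384 (bookkeeping)] -/
theorem badClassK₁₃_existsReading_eq_biUnion (kr : ℕ → (Σ K, SiteSeqKey F (K₀ + K)) → (Σ K, SiteSeqKey F (K₀ + K))) (bd : ℕ → ℕ → (Σ K, SiteSeqKey F (K₀ + K)) → Prop)
    (J : ℕ → Finset ℕ) (K : ℕ) (t : ℝ) :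
    badClassK₁₃ θ K₀ g₀ kr (fun K u => ∃ j ∈ J K, bd j K u) K t = (J K).biUnion fun j => badClassK₁₃ θ K₀ g₀ kr (bd j) K t := by
  ext u
  simp only [mem_badClassK₁₃_iff, Finset.mem_biUnion]
  exact ⟨fun ⟨hu, j, hj, hb⟩ => ⟨j, hj, hu, hb⟩, fun ⟨j, hj, hu, hb⟩ => ⟨hu, j, hj, hb⟩⟩

/-- **★★ THE READING's `W` IS SUBADDITIVE IN THE BAD READING**: if ON THE COARSE CLASS SET the bad reading implies one of finitely many piece readings `bd_j`, `j ∈ J`, then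
`W(bd) K ≤ Σ_{j∈J} W(bd_j) K` (each piece `bd_j : BadKeyReading₁₃ N K₀` read at the same dial and carriers). [cite: King1986, (3.10)–(3.11) p.656; Balaban1989LargeFieldII, (1.80) p.384 (bookkeeping)] -/
theorem W_crOfRecord₁₃KAt_le_sum_of_subset_biUnion (bdU : BadKeyReading₁₃ N K₀) (bd : ℕ → BadKeyReading₁₃ N K₀) (J : Finset ℕ) (K : ℕ)
    (hU : ∀ u ∈ classSetK₁₃ θ K₀ g₀ (krR F θ hP g₀ os) K, bdU F θ hP g₀ os K u → ∃ j ∈ J, bd j F θ hP g₀ os K u) :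
    (crOfRecord₁₃KAt K₀ krR bdU sh F θ hP g₀ os).W K ≤ ∑ j ∈ J, (crOfRecord₁₃KAt K₀ krR (bd j) sh F θ hP g₀ os).W K :=
  wInf_le_sum_wInf_of_subset_biUnion (Bad := fun j => badClassK₁₃ θ K₀ g₀ (krR F θ hP g₀ os) (bd j F θ hP g₀ os))
    (fun t _ u _ => weightAK₁₃_nonneg_of_provisos θ hP K₀ g₀ os (krR F θ hP g₀ os) K t u)
    (fun t _ u _ => weightBK₁₃_nonneg_of_provisos θ hP K₀ g₀ os (krR F θ hP g₀ os) K t u)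
    (fun j _ t _ => badClassK₁₃_subset θ K₀ g₀ (krR F θ hP g₀ os) (bd j F θ hP g₀ os) K t)
    (fun t _ u hu => by
      rw [mem_badClassK₁₃_iff] at hu
      obtain ⟨j, hj, hb⟩ := hU u hu.1 hu.2
      exact Finset.mem_biUnion.2 ⟨j, hj, (mem_badClassK₁₃_iff θ K₀ g₀ _ (bd j F θ hP g₀ os) K t u).2 ⟨hu.1, hb⟩⟩)
    fun j _ => ⟨1, one_mem_admW_carriersK₁₃ θ hP K₀ g₀ os (krR F θ hP g₀ os) (bd j F θ hP g₀ os) K⟩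

/-- **★★ N20 AT A UNION-DOMINATED READING FROM PER-PIECE BUDGETS**: at every step the bad reading implies (on the class set) one of the pieces `bd_j`, `j ∈ J K`; budgets `w j K` on the
pieces' canonical weights with `Σ_{j∈J K} w j K < 1` summable over `K` ⇒ `RelWeightBound` AT `crOfRecord₁₃KAt K₀ kr bd sh F θ hP g₀ os` with its canonical `W`.  The budgets are NE7b's
body piece by piece — NAMED OPEN. [cite: Balaban1989LargeFieldII, Thm 1 + (0.1) pp.355–356, (1.80) p.384; King1986, (3.10)–(3.11) p.656 (bookkeeping)] -/
theorem relWeightBound_crOfRecord₁₃KAt_of_pieceBudgets (bdU : BadKeyReading₁₃ N K₀) (bd : ℕ → BadKeyReading₁₃ N K₀) (J : ℕ → Finset ℕ) {w : ℕ → ℕ → ℝ}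
    (hU : ∀ K, ∀ u ∈ classSetK₁₃ θ K₀ g₀ (krR F θ hP g₀ os) K, bdU F θ hP g₀ os K u → ∃ j ∈ J K, bd j F θ hP g₀ os K u)
    (hw : ∀ K, ∀ j ∈ J K, (crOfRecord₁₃KAt K₀ krR (bd j) sh F θ hP g₀ os).W K ≤ w j K)
    (hlt : ∀ K, ∑ j ∈ J K, w j K < 1) (hsum : Summable fun K => ∑ j ∈ J K, w j K) :
    RelWeightBound (crOfRecord₁₃KAt K₀ krR bdU sh F θ hP g₀ os).l₀ (crOfRecord₁₃KAt K₀ krR bdU sh F θ hP g₀ os).T (crOfRecord₁₃KAt K₀ krR bdU sh F θ hP g₀ os).A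
      (crOfRecord₁₃KAt K₀ krR bdU sh F θ hP g₀ os).B (crOfRecord₁₃KAt K₀ krR bdU sh F θ hP g₀ os).Bad (crOfRecord₁₃KAt K₀ krR bdU sh F θ hP g₀ os).W := by
  have hle : ∀ K, (crOfRecord₁₃KAt K₀ krR bdU sh F θ hP g₀ os).W K ≤ ∑ j ∈ J K, w j K := fun K =>
    (W_crOfRecord₁₃KAt_le_sum_of_subset_biUnion θ hP K₀ g₀ os krR sh bdU bd (J K) K (hU K)).trans (Finset.sum_le_sum (hw K))
  exact (relWeightBound_crOfRecord₁₃KAt_iff θ hP K₀ g₀ os krR bdU sh).2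
    ⟨fun K => (hle K).trans_lt (hlt K), Summable.of_nonneg_of_le (fun K => wInf_nonneg K) hle hsum⟩

end Union

/-! ## §3  The PENDING-shaped dial (P): a union over the window's levels of per-level size thresholds growing linearly with the age -/
section Pending
variable (θ : Stage13HParams F N) (hP : θ.Provisos₁₃CoPH F N) (K₀ : ℕ) (g₀ : ℕ → ℝ) (os : List (ULoop F)) (krR : KeyReading₁₃ N K₀) (bdP : BadKeyReading₁₃ N K₀)
  (sh : ShellSplit₁₃CoPH N K₀)
  (φR : ℕ → (F : T4Family) → (θ : Stage13HParams F N) → θ.Provisos₁₃CoPH F N → (ℕ → ℝ) → List (ULoop F) → ℕ → (Σ K, SiteSeqKey F (K₀ + K)) → ℕ)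
  (nR : ℕ → FloorReading₁₃ N) (jcut : ℕ → ℕ)
  (hbd : ∀ K, ∀ u ∈ classSetK₁₃ θ K₀ g₀ (krR F θ hP g₀ os) K,
    (bdP F θ hP g₀ os K u ↔ ∃ j ∈ Finset.range (jcut K), nR j F θ hP g₀ os K ≤ φR j F θ hP g₀ os K u))
  [DecidableEq (Σ K, SiteSeqKey F (K₀ + K))]
include hbd

/-- **★★ THE PENDING DIAL UNDER PER-(LEVEL, SIZE) GEOMETRIC LETTERS**: at step `K`, for every level `j < jcut K` the classes with `φ j K = m` carry at most `V·q^m` of each run's keyed mass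
for the sizes `m ≥ n j K` ONLY (`0 ≤ q < 1`, `V ≥ 0`, `|t| ≤ 1`) ⇒ `W K ≤ Σ_{j<jcut K} V·q^{n j K}∕(1−q)` (§2 subadditivity + p620106 §3 per level).
[cite: Balaban1989LargeFieldII, (1.80) p.384, (1.89) p.387; Balaban1989LargeFieldI, (0.2) p.176; King1986, (3.10)–(3.11) p.656 (bookkeeping)] -/
theorem W_crOfRecord₁₃KAt_pending_le_sum_geometric {q V : ℝ} (h0 : 0 ≤ q) (h1 : q < 1) (hV : 0 ≤ V) (K : ℕ)
    (hA : ∀ j < jcut K, ∀ t : ℝ, |t| ≤ 1 → ∀ m, nR j F θ hP g₀ os K ≤ m →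
      ∑ u ∈ (classSetK₁₃ θ K₀ g₀ (krR F θ hP g₀ os) K).filter (fun u => φR j F θ hP g₀ os K u = m), weightAK₁₃ θ hP K₀ g₀ os (krR F θ hP g₀ os) K t u ≤
        V * q ^ m * ∑ u ∈ classSetK₁₃ θ K₀ g₀ (krR F θ hP g₀ os) K, weightAK₁₃ θ hP K₀ g₀ os (krR F θ hP g₀ os) K t u)
    (hB : ∀ j < jcut K, ∀ t : ℝ, |t| ≤ 1 → ∀ m, nR j F θ hP g₀ os K ≤ m →
      ∑ u ∈ (classSetK₁₃ θ K₀ g₀ (krR F θ hP g₀ os) K).filter (fun u => φR j F θ hP g₀ os K u = m), weightBK₁₃ θ hP K₀ g₀ os (krR F θ hP g₀ os) K t u ≤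
        V * q ^ m * ∑ u ∈ classSetK₁₃ θ K₀ g₀ (krR F θ hP g₀ os) K, weightBK₁₃ θ hP K₀ g₀ os (krR F θ hP g₀ os) K t u) :
    (crOfRecord₁₃KAt K₀ krR bdP sh F θ hP g₀ os).W K ≤ ∑ j ∈ Finset.range (jcut K), V * q ^ nR j F θ hP g₀ os K / (1 - q) := by
  refine (W_crOfRecord₁₃KAt_le_sum_of_subset_biUnion θ hP K₀ g₀ os krR sh bdP (fun j F θ hP g₀ os K u => nR j F θ hP g₀ os K ≤ φR j F θ hP g₀ os K u)
    (Finset.range (jcut K)) K fun u hu hb => (hbd K u hu).1 hb).trans (Finset.sum_le_sum fun j hj => ?_)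
  exact W_crOfRecord₁₃KAt_thr_le_geometric θ hP K₀ g₀ os krR (fun F θ hP g₀ os K u => nR j F θ hP g₀ os K ≤ φR j F θ hP g₀ os K u) sh
    (φR j F θ hP g₀ os) (nR j F θ hP g₀ os) (fun _ _ _ => Iff.rfl) h0 h1 hV K (hA j (Finset.mem_range.1 hj)) (hB j (Finset.mem_range.1 hj))

/-- **★★ … AND WITH THRESHOLDS LINEAR IN THE AGE THE SUM IS THE AGE MAJORANT AT RATE `q^c`**: `n j K ≥ n₀ K + c·(K₀+K−(j+1))` (`c ≥ 1`), cut inside the window ⇒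
`W K ≤ V·q^{n₀ K}·(q^c)^{K₀+K−jcut K}∕((1−q)(1−q^c))` — p617084's survival majorant with rate `r := q^c` and entropy `V·q^{n₀ K}∕(1−q)`.
[cite: Balaban1989LargeFieldII, (1.80) p.384, (1.89) p.387; King1986, (3.10)–(3.11) p.656 (bookkeeping)] -/
theorem W_crOfRecord₁₃KAt_pending_le_ageMajorant {q V : ℝ} (h0 : 0 ≤ q) (h1 : q < 1) (hV : 0 ≤ V) {c : ℕ} (hc : 1 ≤ c) (n₀ : ℕ → ℕ) (K : ℕ) (hwin : jcut K ≤ K₀ + K)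
    (hlin : ∀ j < jcut K, n₀ K + c * (K₀ + K - (j + 1)) ≤ nR j F θ hP g₀ os K)
    (hA : ∀ j < jcut K, ∀ t : ℝ, |t| ≤ 1 → ∀ m, nR j F θ hP g₀ os K ≤ m →
      ∑ u ∈ (classSetK₁₃ θ K₀ g₀ (krR F θ hP g₀ os) K).filter (fun u => φR j F θ hP g₀ os K u = m), weightAK₁₃ θ hP K₀ g₀ os (krR F θ hP g₀ os) K t u ≤
        V * q ^ m * ∑ u ∈ classSetK₁₃ θ K₀ g₀ (krR F θ hP g₀ os) K, weightAK₁₃ θ hP K₀ g₀ os (krR F θ hP g₀ os) K t u)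
    (hB : ∀ j < jcut K, ∀ t : ℝ, |t| ≤ 1 → ∀ m, nR j F θ hP g₀ os K ≤ m →
      ∑ u ∈ (classSetK₁₃ θ K₀ g₀ (krR F θ hP g₀ os) K).filter (fun u => φR j F θ hP g₀ os K u = m), weightBK₁₃ θ hP K₀ g₀ os (krR F θ hP g₀ os) K t u ≤
        V * q ^ m * ∑ u ∈ classSetK₁₃ θ K₀ g₀ (krR F θ hP g₀ os) K, weightBK₁₃ θ hP K₀ g₀ os (krR F θ hP g₀ os) K t u) :
    (crOfRecord₁₃KAt K₀ krR bdP sh F θ hP g₀ os).W K ≤ V * q ^ n₀ K * (q ^ c) ^ (K₀ + K - jcut K) / ((1 - q) * (1 - q ^ c)) := by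
  refine (W_crOfRecord₁₃KAt_pending_le_sum_geometric θ hP K₀ g₀ os krR bdP sh φR nR jcut hbd h0 h1 hV K hA hB).trans ?_
  have hq1 : 0 < 1 - q := sub_pos.2 h1
  have hs := sum_range_pow_threshold_le h0 h1 hc (n₀ := n₀ K) (n := fun j => nR j F θ hP g₀ os K) hwin hlin
  calc ∑ j ∈ Finset.range (jcut K), V * q ^ nR j F θ hP g₀ os K / (1 - q) = V / (1 - q) * ∑ j ∈ Finset.range (jcut K), q ^ nR j F θ hP g₀ os K := by
        rw [Finset.mul_sum]; exact Finset.sum_congr rfl fun j _ => by ring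
    _ ≤ V / (1 - q) * (q ^ n₀ K * ((q ^ c) ^ (K₀ + K - jcut K) / (1 - q ^ c))) := mul_le_mul_of_nonneg_left hs (div_nonneg hV hq1.le)
    _ = V * q ^ n₀ K * (q ^ c) ^ (K₀ + K - jcut K) / ((1 - q) * (1 - q ^ c)) := by
        field_simp

/-- **★★★ N20 AT THE PENDING DIAL — THE DESIGN RULE (the age rule at rate `q^c`)**: `0 ≤ q < 1`, `V ≥ 0`, slope `c ≥ 1`, thresholds `n j K ≥ n₀ K + c·(K₀+K−(j+1))`, cut inside the window,
and a threshold-floor ∕ age-floor budget `V·q^{n₀ K}·(q^c)^{K₀+K−jcut K} < (1−q)(1−q^c)` at every step, summable over the steps; per-(level, size) geometric letters above the thresholds ⇒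
`RelWeightBound` AT `crOfRecord₁₃KAt K₀ kr bd sh F θ hP g₀ os`.  The letters are the hypothesis — NE7b's body level by level in the size currency, NAMED OPEN.
[cite: Balaban1989LargeFieldII, Thm 1 + (0.1) pp.355–356, (1.80) p.384, (1.89) p.387; Balaban1989LargeFieldI, (0.2) p.176; King1986, (3.10)–(3.11) p.656 (bookkeeping)] -/
theorem relWeightBound_crOfRecord₁₃KAt_pending_of_geometric {q V : ℝ} (h0 : 0 ≤ q) (h1 : q < 1) (hV : 0 ≤ V) {c : ℕ} (hc : 1 ≤ c) (n₀ : ℕ → ℕ)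
    (hwin : ∀ K, jcut K ≤ K₀ + K) (hlin : ∀ K, ∀ j < jcut K, n₀ K + c * (K₀ + K - (j + 1)) ≤ nR j F θ hP g₀ os K)
    (hbud : ∀ K, V * q ^ n₀ K * (q ^ c) ^ (K₀ + K - jcut K) < (1 - q) * (1 - q ^ c))
    (hsum : Summable fun K => V * q ^ n₀ K * (q ^ c) ^ (K₀ + K - jcut K))
    (hA : ∀ K, ∀ j < jcut K, ∀ t : ℝ, |t| ≤ 1 → ∀ m, nR j F θ hP g₀ os K ≤ m →
      ∑ u ∈ (classSetK₁₃ θ K₀ g₀ (krR F θ hP g₀ os) K).filter (fun u => φR j F θ hP g₀ os K u = m), weightAK₁₃ θ hP K₀ g₀ os (krR F θ hP g₀ os) K t u ≤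
        V * q ^ m * ∑ u ∈ classSetK₁₃ θ K₀ g₀ (krR F θ hP g₀ os) K, weightAK₁₃ θ hP K₀ g₀ os (krR F θ hP g₀ os) K t u)
    (hB : ∀ K, ∀ j < jcut K, ∀ t : ℝ, |t| ≤ 1 → ∀ m, nR j F θ hP g₀ os K ≤ m →
      ∑ u ∈ (classSetK₁₃ θ K₀ g₀ (krR F θ hP g₀ os) K).filter (fun u => φR j F θ hP g₀ os K u = m), weightBK₁₃ θ hP K₀ g₀ os (krR F θ hP g₀ os) K t u ≤
        V * q ^ m * ∑ u ∈ classSetK₁₃ θ K₀ g₀ (krR F θ hP g₀ os) K, weightBK₁₃ θ hP K₀ g₀ os (krR F θ hP g₀ os) K t u) :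
    RelWeightBound (crOfRecord₁₃KAt K₀ krR bdP sh F θ hP g₀ os).l₀ (crOfRecord₁₃KAt K₀ krR bdP sh F θ hP g₀ os).T (crOfRecord₁₃KAt K₀ krR bdP sh F θ hP g₀ os).A
      (crOfRecord₁₃KAt K₀ krR bdP sh F θ hP g₀ os).B (crOfRecord₁₃KAt K₀ krR bdP sh F θ hP g₀ os).Bad (crOfRecord₁₃KAt K₀ krR bdP sh F θ hP g₀ os).W := by
  have hden : 0 < (1 - q) * (1 - q ^ c) := mul_pos (sub_pos.2 h1) (sub_pos.2 (pow_lt_one₀ h0 h1 (by omega)))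
  have hle : ∀ K, (crOfRecord₁₃KAt K₀ krR bdP sh F θ hP g₀ os).W K ≤ V * q ^ n₀ K * (q ^ c) ^ (K₀ + K - jcut K) / ((1 - q) * (1 - q ^ c)) := fun K =>
    W_crOfRecord₁₃KAt_pending_le_ageMajorant θ hP K₀ g₀ os krR bdP sh φR nR jcut hbd h0 h1 hV hc n₀ K (hwin K) (hlin K) (hA K) (hB K)
  refine (relWeightBound_crOfRecord₁₃KAt_iff θ hP K₀ g₀ os krR bdP sh).2 ⟨fun K => (hle K).trans_lt ((div_lt_one hden).2 (hbud K)), ?_⟩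
  exact Summable.of_nonneg_of_le (fun K => wInf_nonneg K) hle (hsum.div_const _)

/-- **… from a CONSTANT threshold floor `n₀` and a LINEAR AGE FLOOR** (gen 3's rule verbatim at rate `q^c`): minimal age `a₀` with `V·q^{n₀}·(q^c)^{a₀} < (1−q)(1−q^c)`,
`a₀ ≤ K₀+K−jcut K`, `c'·K ≤ K₀+K−jcut K` (`c' > 0`), `0 < q`. [cite: Balaban1989LargeFieldII, Thm 1 + (0.1) pp.355–356, (1.80) p.384, (1.89) p.387; King1986, (3.10)–(3.11) p.656 (bookkeeping)] -/
theorem relWeightBound_crOfRecord₁₃KAt_pending_of_geometric_linearAge {q V c' : ℝ} (h0 : 0 < q) (h1 : q < 1) (hV : 0 ≤ V) {c : ℕ} (hc : 1 ≤ c) {n₀ a₀ : ℕ} (hc' : 0 < c')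
    (hwin : ∀ K, jcut K ≤ K₀ + K) (hlin : ∀ K, ∀ j < jcut K, n₀ + c * (K₀ + K - (j + 1)) ≤ nR j F θ hP g₀ os K)
    (hthr : V * q ^ n₀ * (q ^ c) ^ a₀ < (1 - q) * (1 - q ^ c)) (hfloor : ∀ K, a₀ ≤ K₀ + K - jcut K) (hfrac : ∀ K : ℕ, c' * K ≤ ((K₀ + K - jcut K : ℕ) : ℝ))
    (hA : ∀ K, ∀ j < jcut K, ∀ t : ℝ, |t| ≤ 1 → ∀ m, nR j F θ hP g₀ os K ≤ m →
      ∑ u ∈ (classSetK₁₃ θ K₀ g₀ (krR F θ hP g₀ os) K).filter (fun u => φR j F θ hP g₀ os K u = m), weightAK₁₃ θ hP K₀ g₀ os (krR F θ hP g₀ os) K t u ≤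
        V * q ^ m * ∑ u ∈ classSetK₁₃ θ K₀ g₀ (krR F θ hP g₀ os) K, weightAK₁₃ θ hP K₀ g₀ os (krR F θ hP g₀ os) K t u)
    (hB : ∀ K, ∀ j < jcut K, ∀ t : ℝ, |t| ≤ 1 → ∀ m, nR j F θ hP g₀ os K ≤ m →
      ∑ u ∈ (classSetK₁₃ θ K₀ g₀ (krR F θ hP g₀ os) K).filter (fun u => φR j F θ hP g₀ os K u = m), weightBK₁₃ θ hP K₀ g₀ os (krR F θ hP g₀ os) K t u ≤
        V * q ^ m * ∑ u ∈ classSetK₁₃ θ K₀ g₀ (krR F θ hP g₀ os) K, weightBK₁₃ θ hP K₀ g₀ os (krR F θ hP g₀ os) K t u) :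
    RelWeightBound (crOfRecord₁₃KAt K₀ krR bdP sh F θ hP g₀ os).l₀ (crOfRecord₁₃KAt K₀ krR bdP sh F θ hP g₀ os).T (crOfRecord₁₃KAt K₀ krR bdP sh F θ hP g₀ os).A
      (crOfRecord₁₃KAt K₀ krR bdP sh F θ hP g₀ os).B (crOfRecord₁₃KAt K₀ krR bdP sh F θ hP g₀ os).Bad (crOfRecord₁₃KAt K₀ krR bdP sh F θ hP g₀ os).W := by
  have hq0 : 0 ≤ q := h0.le
  have hr0 : 0 < q ^ c := pow_pos h0 c
  have hr1 : q ^ c < 1 := pow_lt_one₀ hq0 h1 (by omega)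
  have hVn : 0 ≤ V * q ^ n₀ := mul_nonneg hV (pow_nonneg hq0 _)
  refine relWeightBound_crOfRecord₁₃KAt_pending_of_geometric θ hP K₀ g₀ os krR bdP sh φR nR jcut hbd hq0 h1 hV hc (fun _ => n₀) hwin hlin (fun K => ?_) ?_ hA hB
  · exact (mul_le_mul_of_nonneg_left (pow_le_pow_of_le_one hr0.le hr1.le (hfloor K)) hVn).trans_lt hthr
  · exact summable_ageMajorant_of_linearAge hr0 hr1 hVn hc' hfrac

/-- **… from a THRESHOLD FLOOR ALONE (no cut needed — the whole window may be booked, `jcut K = K₀ + K` allowed)**: `V·q^{n₀ K} < (1−q)(1−q^c)` at every step and `Σ_K V·q^{n₀ K} < ∞`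
(e.g. `n₀ K` linear in `K`, `…ValueStrata.summable_geomThreshold_of_linear`) ⇒ the face, since `(q^c)^{age} ≤ 1`.  In the pending shape the CUT dial of v5 is thus dispensable in a contentful
way: young levels stay booked, but only above their (small) thresholds. [cite: Balaban1989LargeFieldII, Thm 1 + (0.1) pp.355–356, (1.80) p.384, (1.89) p.387; King1986, (3.10)–(3.11) p.656 (bookkeeping)] -/
theorem relWeightBound_crOfRecord₁₃KAt_pending_of_geometric_thresholdFloor {q V : ℝ} (h0 : 0 ≤ q) (h1 : q < 1) (hV : 0 ≤ V) {c : ℕ} (hc : 1 ≤ c) (n₀ : ℕ → ℕ)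
    (hwin : ∀ K, jcut K ≤ K₀ + K) (hlin : ∀ K, ∀ j < jcut K, n₀ K + c * (K₀ + K - (j + 1)) ≤ nR j F θ hP g₀ os K)
    (hbud : ∀ K, V * q ^ n₀ K < (1 - q) * (1 - q ^ c)) (hsum : Summable fun K => V * q ^ n₀ K)
    (hA : ∀ K, ∀ j < jcut K, ∀ t : ℝ, |t| ≤ 1 → ∀ m, nR j F θ hP g₀ os K ≤ m →
      ∑ u ∈ (classSetK₁₃ θ K₀ g₀ (krR F θ hP g₀ os) K).filter (fun u => φR j F θ hP g₀ os K u = m), weightAK₁₃ θ hP K₀ g₀ os (krR F θ hP g₀ os) K t u ≤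
        V * q ^ m * ∑ u ∈ classSetK₁₃ θ K₀ g₀ (krR F θ hP g₀ os) K, weightAK₁₃ θ hP K₀ g₀ os (krR F θ hP g₀ os) K t u)
    (hB : ∀ K, ∀ j < jcut K, ∀ t : ℝ, |t| ≤ 1 → ∀ m, nR j F θ hP g₀ os K ≤ m →
      ∑ u ∈ (classSetK₁₃ θ K₀ g₀ (krR F θ hP g₀ os) K).filter (fun u => φR j F θ hP g₀ os K u = m), weightBK₁₃ θ hP K₀ g₀ os (krR F θ hP g₀ os) K t u ≤
        V * q ^ m * ∑ u ∈ classSetK₁₃ θ K₀ g₀ (krR F θ hP g₀ os) K, weightBK₁₃ θ hP K₀ g₀ os (krR F θ hP g₀ os) K t u) :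
    RelWeightBound (crOfRecord₁₃KAt K₀ krR bdP sh F θ hP g₀ os).l₀ (crOfRecord₁₃KAt K₀ krR bdP sh F θ hP g₀ os).T (crOfRecord₁₃KAt K₀ krR bdP sh F θ hP g₀ os).A
      (crOfRecord₁₃KAt K₀ krR bdP sh F θ hP g₀ os).B (crOfRecord₁₃KAt K₀ krR bdP sh F θ hP g₀ os).Bad (crOfRecord₁₃KAt K₀ krR bdP sh F θ hP g₀ os).W := by
  have hqc0 : 0 ≤ q ^ c := pow_nonneg h0 c
  have hqc1 : q ^ c ≤ 1 := pow_le_one₀ h0 h1.le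
  have hle : ∀ K, V * q ^ n₀ K * (q ^ c) ^ (K₀ + K - jcut K) ≤ V * q ^ n₀ K := fun K =>
    mul_le_of_le_one_right (mul_nonneg hV (pow_nonneg h0 _)) (pow_le_one₀ hqc0 hqc1)
  exact relWeightBound_crOfRecord₁₃KAt_pending_of_geometric θ hP K₀ g₀ os krR bdP sh φR nR jcut hbd h0 h1 hV hc n₀ hwin hlin (fun K => (hle K).trans_lt (hbud K))
    (Summable.of_nonneg_of_le (fun K => mul_nonneg (mul_nonneg hV (pow_nonneg h0 _)) (pow_nonneg hqc0 _)) hle hsum) hA hB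

end Pending

/-! ## §4  Instance: the pending dial AT dag-n20-d's NAMED forgiving key, pieces «un-absorbed large-field volume at level `j+1` ≥ threshold» -/
section Forgive
variable (θ : Stage13HParams F N) (hP : θ.Provisos₁₃CoPH F N) (K₀ : ℕ) (g₀ : ℕ → ℝ) (os : List (ULoop F)) (cR jcR : FloorReading₁₃ N) (nR : ℕ → FloorReading₁₃ N)
  (sh : ShellSplit₁₃CoPH N K₀) [DecidableEq (Σ K, SiteSeqKey F (K₀ + K))]

/-- **★★ THE PENDING-SHAPED DIAL (P) AT THE COMPONENT-FORGIVING KEY — DESIGN RULE**: at `forgiveCompReading₁₃ K₀ cR` the level-`j+1` large-field volume of the FORGIVEN key counts the sites of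
the components of `Z_{j+1}` NOT absorbed by the floor's structure (levels `≤ cR` carry none), so the reading «`∃ j < jcR`, un-absorbed volume at level `j+1` ≥ `nR j`» (read at the key's own
step, dag-n20-d's spelling convention) books exactly the histories with a LARGE-FOR-ITS-AGE new structure in the window; thresholds `nR j K ≥ n₀ K + c·(K₀+K−(j+1))`, per-(level, size)
geometric letters above them, and the budget `V·q^{n₀ K}·(q^c)^{K₀+K−jcR K} < (1−q)(1−q^c)` summable over `K` ⇒ the N20 face there.  HYPOTHESIS = NE7b's body at the window key in the
joint (age × size) currency, NAMED OPEN. [cite: Balaban1989LargeFieldII, Thm 1 + (0.1) pp.355–356, (1.80) p.384, (1.85) p.386, (1.89) p.387; Balaban1989LargeFieldI, (0.2) p.176; King1986, (3.10)–(3.11) p.656 (bookkeeping)] -/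
theorem relWeightBound_forgiveCompReading₁₃_pending_of_geometric {q V : ℝ} (h0 : 0 ≤ q) (h1 : q < 1) (hV : 0 ≤ V) {c : ℕ} (hc : 1 ≤ c) (n₀ : ℕ → ℕ)
    (hwin : ∀ K, jcR F θ hP g₀ os K ≤ K₀ + K) (hlin : ∀ K, ∀ j < jcR F θ hP g₀ os K, n₀ K + c * (K₀ + K - (j + 1)) ≤ nR j F θ hP g₀ os K)
    (hbud : ∀ K, V * q ^ n₀ K * (q ^ c) ^ (K₀ + K - jcR F θ hP g₀ os K) < (1 - q) * (1 - q ^ c))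
    (hsum : Summable fun K => V * q ^ n₀ K * (q ^ c) ^ (K₀ + K - jcR F θ hP g₀ os K))
    (hA : ∀ K, ∀ j < jcR F θ hP g₀ os K, ∀ t : ℝ, |t| ≤ 1 → ∀ m, nR j F θ hP g₀ os K ≤ m →
      ∑ u ∈ (classSetK₁₃ θ K₀ g₀ (forgiveCompReading₁₃ K₀ cR F θ hP g₀ os) K).filter (fun u => largeFieldVolume (j + 1) u.2 = m),
          weightAK₁₃ θ hP K₀ g₀ os (forgiveCompReading₁₃ K₀ cR F θ hP g₀ os) K t u ≤
        V * q ^ m * ∑ u ∈ classSetK₁₃ θ K₀ g₀ (forgiveCompReading₁₃ K₀ cR F θ hP g₀ os) K, weightAK₁₃ θ hP K₀ g₀ os (forgiveCompReading₁₃ K₀ cR F θ hP g₀ os) K t u)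
    (hB : ∀ K, ∀ j < jcR F θ hP g₀ os K, ∀ t : ℝ, |t| ≤ 1 → ∀ m, nR j F θ hP g₀ os K ≤ m →
      ∑ u ∈ (classSetK₁₃ θ K₀ g₀ (forgiveCompReading₁₃ K₀ cR F θ hP g₀ os) K).filter (fun u => largeFieldVolume (j + 1) u.2 = m),
          weightBK₁₃ θ hP K₀ g₀ os (forgiveCompReading₁₃ K₀ cR F θ hP g₀ os) K t u ≤
        V * q ^ m * ∑ u ∈ classSetK₁₃ θ K₀ g₀ (forgiveCompReading₁₃ K₀ cR F θ hP g₀ os) K, weightBK₁₃ θ hP K₀ g₀ os (forgiveCompReading₁₃ K₀ cR F θ hP g₀ os) K t u) :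
    RelWeightBound
      (crOfRecord₁₃KAt K₀ (forgiveCompReading₁₃ K₀ cR)
        (fun F θ hP g₀ os _ x => ∃ j ∈ Finset.range (jcR F θ hP g₀ os x.1), nR j F θ hP g₀ os x.1 ≤ largeFieldVolume (j + 1) x.2) sh F θ hP g₀ os).l₀
      (crOfRecord₁₃KAt K₀ (forgiveCompReading₁₃ K₀ cR)
        (fun F θ hP g₀ os _ x => ∃ j ∈ Finset.range (jcR F θ hP g₀ os x.1), nR j F θ hP g₀ os x.1 ≤ largeFieldVolume (j + 1) x.2) sh F θ hP g₀ os).T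
      (crOfRecord₁₃KAt K₀ (forgiveCompReading₁₃ K₀ cR)
        (fun F θ hP g₀ os _ x => ∃ j ∈ Finset.range (jcR F θ hP g₀ os x.1), nR j F θ hP g₀ os x.1 ≤ largeFieldVolume (j + 1) x.2) sh F θ hP g₀ os).A
      (crOfRecord₁₃KAt K₀ (forgiveCompReading₁₃ K₀ cR)
        (fun F θ hP g₀ os _ x => ∃ j ∈ Finset.range (jcR F θ hP g₀ os x.1), nR j F θ hP g₀ os x.1 ≤ largeFieldVolume (j + 1) x.2) sh F θ hP g₀ os).B
      (crOfRecord₁₃KAt K₀ (forgiveCompReading₁₃ K₀ cR)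
        (fun F θ hP g₀ os _ x => ∃ j ∈ Finset.range (jcR F θ hP g₀ os x.1), nR j F θ hP g₀ os x.1 ≤ largeFieldVolume (j + 1) x.2) sh F θ hP g₀ os).Bad
      (crOfRecord₁₃KAt K₀ (forgiveCompReading₁₃ K₀ cR)
        (fun F θ hP g₀ os _ x => ∃ j ∈ Finset.range (jcR F θ hP g₀ os x.1), nR j F θ hP g₀ os x.1 ≤ largeFieldVolume (j + 1) x.2) sh F θ hP g₀ os).W := by
  refine relWeightBound_crOfRecord₁₃KAt_pending_of_geometric θ hP K₀ g₀ os (forgiveCompReading₁₃ K₀ cR) _ sh (fun j F θ hP g₀ os K u => largeFieldVolume (j + 1) u.2) nR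
    (jcR F θ hP g₀ os) (fun K u hu => ?_) h0 h1 hV hc n₀ hwin hlin hbud hsum hA hB
  obtain ⟨K', y⟩ := u
  obtain rfl : K' = K :=
    fst_eq_of_mem_classSetK₁₃ θ K₀ g₀ _ (fun K x hx => forgiveKeyCompSigma_fst_eq θ K₀ g₀ (cR F θ hP g₀ os) K x hx) K hu
  exact Iff.rfl

end Forgive

end Summit.QuantumFields.YangMills.BalabanUVNodes.N20KeyedRelWeightUnionReading

end
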